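import Summits.BirchSwinnertonDyer.BirchSwinnertonDyer.Theses.TameQuarticSolvent
import Summits.BirchSwinnertonDyer.BirchSwinnertonDyer.Theorems.TameQuarticSolventSolventPairLowerBoundOfV6
import Summits.BirchSwinnertonDyer.BirchSwinnertonDyer.Theorems.TameQuarticSolventSolventPairLowerBoundKolyvaginTwistedUpperAnalyticHalfAnyMult
import HarnessLib

/-!
# Route `TameQuarticSolvent`, crux `SolventPairLowerBound` (stmt-BirchSwinnertonDyer-21391, SPLIT gen 1) —
# the child K2a-rest `KolyvaginTwistedUpperOverKNoOddMult` (stmt-BirchSwinnertonDyer-23965, ≤ 71 classes) BY NAME from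
# a dyadic Euler-system half (52 classes) and the all-additive residue (19 classes); the parent BY NAME from its filed
# children plus those two pieces

HONEST FRAMING. Theorems only; helper (`--supports stmt-BirchSwinnertonDyer-23965`, width seat `bsd-wall-tqs-p1-w2`,
gen 2), CONDITIONAL on every displayed hypothesis; credits nothing toward closing any item and proves none of the
research statements. The route-level split of the deciding crux (rev 3, texts = skeleton v6 of line `birth`):
21391 ⇐ `SolventPublishedInputs` (23962, PUB⁸ by name) · `LowerBSD3OverSolventQuartic` (23963, K1⁻ — the open crux) ·
`KolyvaginUpperRankZeroOverK` (23964, K2a-ES₀: Euler-system half in analytic rank zero on the 3 462 classes with an ODD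
multiplicative prime `ℓ₀ ≠ 3`) · `KolyvaginTwistedUpperOverKNoOddMult` (23965, K2a-rest: the v5 K2a text on the ≤ 71
classes WITHOUT an odd multiplicative prime) + glue 23966. The filed why-might-fail of 23965 names two obstacles: (i) on
the 19 all-additive classes no admissible `β` need flip a local sign; (ii) «the analytic nonvanishing input over `K` with
prescribed local behaviour at `2` is not a named fact yet». Obstacle (ii) is now removed: the named fact
`friedbergHoffstein_exists_twist_ne_zero_realQuadratic_tameAtThree_anyMult` (p587947 — Friedberg–Hoffstein Thm. B(1)
over `K` in the «flip» class at ANY multiplicative `ℓ₀ ≠ 3`, the flip at `𝔮 ∣ ℓ₀` being the UNRAMIFIED quadratic twist,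
written uniformly via Hecke's decomposition law and swapping split/non-split reduction of the Tate curve whatever the
residue characteristic) feeds `exists_totallyPositive_oddAtThree_twist_L_ne_zero_of_friedbergHoffstein_anyMult`
(p588294): the analytic half on every row with a multiplicative prime `≠ 3`. Hence this file:
* `kolyvaginTwistedUpperOverKNoOddMult_of_ES0two_of_allAdditive` — the CHILD 23965 BY NAME from modularity, the two
  Friedberg–Hoffstein-over-`K` facts (any-`ℓ₀` flip, no-flip), **K2a-ES₀⁽²⁾** (the text of 23964 with «odd multiplicative
  `ℓ₀ ≠ 3`» replaced by «multiplicative at `2`»: the SAME research statement — sharp `3`-part rank-zero Kolyvagin upper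
  bound for `E′ = (E_K)^{(β)}` over the real quadratic `K` at the good supersingular `𝔭 ∣ 3`, Jacquet–Langlands place =
  the dyadic multiplicative place — on the 52 classes whose only multiplicative prime is `2`) and **K2a-rest₁₉** (the
  text of 23965 under «NO multiplicative prime `≠ 3`»: exactly the 19 census classes with every bad prime additive,
  `Cruxes/SolventPairLowerBound/PARITY-K2A-w2.md` §2 — 28224e,f · 152100cl,cv · 176400ji · 189225m ·
  324900cq,da,db,df,eb · 412164a,t · 426888ce · 435600em,eu,fm,ha,hd);
* `kolyvaginTwistedUpperOverKNoOddMult_of_ES0any_of_allAdditive` — the same from **K2a-ES₀′** (23964's text with the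
  conjunct `ℓ₀ ≠ 2` dropped, 3 514 classes) in place of K2a-ES₀⁽²⁾;
* `solventPairLowerBound_of_children_of_ES0two_of_allAdditive` — the PARENT 21391 BY NAME from its filed children
  23962 · 23963 · 23964 BY NAME plus the any-`ℓ₀` fact, K2a-ES₀⁽²⁾ and K2a-rest₁₉ (what is left of the parent beyond the
  filed K1⁻ and K2a-ES₀ is exactly: the same Euler-system engine on 52 dyadic classes, and 19 all-additive classes);
* `solventPairLowerBound_of_published_of_K1low_of_K2aES0any_of_allAdditive` — the PARENT BY NAME from
  23962 · any-`ℓ₀` fact · 23963 · K2a-ES₀′ · K2a-rest₁₉ (one-line closer of a v7 re-cut `K1⁻ · K2a-ES₀′ · K2a-rest₁₉`).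
BSD is not proved by any of this.

References: S. Friedberg, J. Hoffstein, Ann. of Math. 142 (1995) Thm. B; E. Hecke, *Lectures on the Theory of
Algebraic Numbers*, §39 Thm. 119; T. Dokchitser, V. Dokchitser, Ann. of Math. 172 (2010) Thm. 2.3; J. S. Milne,
Invent. Math. 17 (1972) Thm. 1; B. Gross, D. Zagier, Invent. Math. 84 (1986) Thm. I.(7.3).
-/

-- D-0017: single-problem summit, so `Summit.BirchSwinnertonDyer.BirchSwinnertonDyer.…` repeats a namespace BY DESIGN.
set_option linter.dupNamespace false

noncomputable section

open scoped Classical NumberField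

open WeierstrassCurve Literature.NumberTheory.EllipticCurves Literature.NumberTheory.EllipticCurves.ModularForms
  Literature.NumberTheory.EllipticCurves.Rank1Residual IsDedekindDomain NumberField
open Summit.BirchSwinnertonDyer.BirchSwinnertonDyer.Theses.TameQuarticSolvent

namespace Summit.BirchSwinnertonDyer.BirchSwinnertonDyer.Theorems.SolventPairLowerBound

/-- **The child K2a-rest (`KolyvaginTwistedUpperOverKNoOddMult`, stmt-BirchSwinnertonDyer-23965) BY NAME from the
dyadic Euler-system half K2a-ES₀⁽²⁾ and the all-additive residue K2a-rest₁₉.** GIVEN modularity (`hmod`),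
Friedberg–Hoffstein Thm. B(1) over `K` in the «flip at any multiplicative `ℓ₀ ≠ 3`» and «no-flip» classes (`hFH`,
`hFH'`), K2a-ES₀⁽²⁾ (`K2aES0two`: for `W` on the leaf with multiplicative reduction at `2`, every admissible `(d, K, β)`
with `L((W_K)^{(β)}, 1) ≠ 0`: `Ш[3^∞]` finite, `#Ш_an ∈ ℚ`, `ord₃ #Ш[3^∞] ≤ ord₃ #Ш_an` — research, sharp `3`-part not
in print) and K2a-rest₁₉ (`K2aRest19`: the child's text on the 19 classes with no multiplicative prime `≠ 3`): for `W`
without an odd multiplicative prime, either `W` is multiplicative at `2` (analytic half at `ℓ₀ = 2`, then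
K2a-ES₀⁽²⁾, `Vβ` = the twist itself) or it has no multiplicative prime `≠ 3` at all (K2a-rest₁₉). CONDITIONAL;
credits nothing. [cite: FriedbergHoffstein1995, Thm. B (1)] [cite: Hecke1981, §39 Thm. 119]
[cite: Kobayashi2002, Thm. 1.1 (i), (ii)] -/
theorem kolyvaginTwistedUpperOverKNoOddMult_of_ES0two_of_allAdditive (hmod : exists_isNewformOf)
    (hFH : friedbergHoffstein_exists_twist_ne_zero_realQuadratic_tameAtThree_anyMult)
    (hFH' : friedbergHoffstein_exists_twist_ne_zero_realQuadratic_tameAtThree_noflip)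
    (K2aES0two :
      ∀ (W : WeierstrassCurve ℚ) [W.IsElliptic] [W.IsGloballyMinimal],
        ¬ W.HasCM → Addv W 3 → Summit.BirchSwinnertonDyer.Rank1Residual.Additive.SubTprime W 3 →
        W.analyticRank = 1 → W.HasMultiplicativeReductionAtPrime 2 →
        ∀ (d : ℤ), 0 < d → padicValInt 3 d = 1 →
        ∀ (K : Type) [Field K] [NumberField K] (θ₁ : K), Module.finrank ℚ K = 2 → θ₁ ^ 2 = (d : K) →
        ∀ β : K,
          (∀ v : HeightOneSpectrum (𝓞 K), ((3 : ℕ) : 𝓞 K) ∈ v.asIdeal →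
            ∃ k : ℤ, v.valuation K β = WithZero.exp (2 * k + 1)) →
          (∀ σ : K →+* ℝ, 0 < σ β) →
          ((W.baseChange K).quadraticTwist β).HasEntireLFunction →
          ((W.baseChange K).quadraticTwist β).entireLFunction 1 ≠ 0 →
          Finite (AddCommGroup.primaryComponent ((W.baseChange K).quadraticTwist β).sha 3) ∧
            ∃ qβ : ℚ, analyticSha ((W.baseChange K).quadraticTwist β) = (qβ : ℂ) ∧
              (padicValNat 3
                  (Nat.card (AddCommGroup.primaryComponent ((W.baseChange K).quadraticTwist β).sha 3)) : ℤ) ≤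
                padicValRat 3 qβ)
    (K2aRest19 :
      ∀ (W : WeierstrassCurve ℚ) [W.IsElliptic] [W.IsGloballyMinimal],
        ¬ W.HasCM → Addv W 3 → Summit.BirchSwinnertonDyer.Rank1Residual.Additive.SubTprime W 3 →
        W.analyticRank = 1 →
        ¬ (∃ (ℓ₀ : ℕ) (_ : Fact ℓ₀.Prime), ℓ₀ ≠ 3 ∧ W.HasMultiplicativeReductionAtPrime ℓ₀) →
        ∀ (d : ℤ), 0 < d → padicValInt 3 d = 1 →
        ∀ (K : Type) [Field K] [NumberField K] (θ₁ : K), Module.finrank ℚ K = 2 → θ₁ ^ 2 = (d : K) →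
          ∃ β : K,
            (∀ v : HeightOneSpectrum (𝓞 K), ((3 : ℕ) : 𝓞 K) ∈ v.asIdeal →
              ∃ k : ℤ, v.valuation K β = WithZero.exp (2 * k + 1)) ∧
            (∀ σ : K →+* ℝ, 0 < σ β) ∧
            ∃ (Vβ : WeierstrassCurve K) (_ : Vβ.IsElliptic),
              (∃ C : WeierstrassCurve.VariableChange K, C • (W.baseChange K).quadraticTwist β = Vβ) ∧
              Vβ.HasEntireLFunction ∧
              Finite (AddCommGroup.primaryComponent Vβ.sha 3) ∧
              ∃ qβ : ℚ, analyticSha Vβ = (qβ : ℂ) ∧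
                (padicValNat 3 (Nat.card (AddCommGroup.primaryComponent Vβ.sha 3)) : ℤ) ≤
                  padicValRat 3 qβ) :
    KolyvaginTwistedUpperOverKNoOddMult := by
  intro W _ _ hCM hadd hsub hr hno d hd0 hd K _ _ θ₁ h2 hθ₁
  by_cases h2mult : W.HasMultiplicativeReductionAtPrime 2
  · have hmult : ∃ (ℓ₀ : ℕ) (_ : Fact ℓ₀.Prime), ℓ₀ ≠ 3 ∧ W.HasMultiplicativeReductionAtPrime ℓ₀ :=
      ⟨2, inferInstance, by decide, h2mult⟩
    obtain ⟨β, hval, hpos, hL, hL1⟩ :=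
      exists_totallyPositive_oddAtThree_twist_L_ne_zero_of_friedbergHoffstein_anyMult hmod hFH hFH'
        W hCM hadd hsub hr hmult d hd0 hd K θ₁ h2 hθ₁
    obtain ⟨hfin, qβ, hqβ, hle⟩ := K2aES0two W hCM hadd hsub hr h2mult d hd0 hd K θ₁ h2 hθ₁ β hval hpos hL hL1
    have hβ0 : β ≠ 0 := by
      intro h0
      obtain ⟨v, hv⟩ := exists_heightOneSpectrum_natCast_mem K 3
      obtain ⟨k, hk⟩ := hval v hv
      rw [h0, map_zero] at hk
      exact WithZero.exp_ne_zero hk.symm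
    haveI : (W.baseChange K).IsElliptic := by rw [WeierstrassCurve.baseChange]; infer_instance
    haveI : NeZero (2 : K) := ⟨two_ne_zero⟩
    exact ⟨β, hval, hpos, (W.baseChange K).quadraticTwist β, isElliptic_quadraticTwist _ hβ0,
      ⟨1, one_smul _ _⟩, hL, hfin, qβ, hqβ, hle⟩
  · have hnone : ¬ ∃ (ℓ₀ : ℕ) (_ : Fact ℓ₀.Prime), ℓ₀ ≠ 3 ∧ W.HasMultiplicativeReductionAtPrime ℓ₀ := by
      rintro ⟨ℓ₀, hp, h3, hm⟩
      by_cases hℓ2 : ℓ₀ = 2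
      · subst hℓ2
        exact h2mult hm
      · exact hno ⟨ℓ₀, hp, hℓ2, h3, hm⟩
    exact K2aRest19 W hCM hadd hsub hr hnone d hd0 hd K θ₁ h2 hθ₁

/-- **The child K2a-rest (stmt-BirchSwinnertonDyer-23965) BY NAME from K2a-ES₀′ and K2a-rest₁₉**, where K2a-ES₀′ is
the text of the sibling 23964 `KolyvaginUpperRankZeroOverK` with the conjunct `ℓ₀ ≠ 2` dropped (the rank-zero
Euler-system half at ANY multiplicative `ℓ₀ ≠ 3`, 3 514 classes): it contains K2a-ES₀⁽²⁾. CONDITIONAL; credits nothing.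
[cite: FriedbergHoffstein1995, Thm. B (1)] [cite: Hecke1981, §39 Thm. 119] -/
theorem kolyvaginTwistedUpperOverKNoOddMult_of_ES0any_of_allAdditive (hmod : exists_isNewformOf)
    (hFH : friedbergHoffstein_exists_twist_ne_zero_realQuadratic_tameAtThree_anyMult)
    (hFH' : friedbergHoffstein_exists_twist_ne_zero_realQuadratic_tameAtThree_noflip)
    (K2aES0any :
      ∀ (W : WeierstrassCurve ℚ) [W.IsElliptic] [W.IsGloballyMinimal],
        ¬ W.HasCM → Addv W 3 → Summit.BirchSwinnertonDyer.Rank1Residual.Additive.SubTprime W 3 →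
        W.analyticRank = 1 →
        (∃ (ℓ₀ : ℕ) (_ : Fact ℓ₀.Prime), ℓ₀ ≠ 3 ∧ W.HasMultiplicativeReductionAtPrime ℓ₀) →
        ∀ (d : ℤ), 0 < d → padicValInt 3 d = 1 →
        ∀ (K : Type) [Field K] [NumberField K] (θ₁ : K), Module.finrank ℚ K = 2 → θ₁ ^ 2 = (d : K) →
        ∀ β : K,
          (∀ v : HeightOneSpectrum (𝓞 K), ((3 : ℕ) : 𝓞 K) ∈ v.asIdeal →
            ∃ k : ℤ, v.valuation K β = WithZero.exp (2 * k + 1)) →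
          (∀ σ : K →+* ℝ, 0 < σ β) →
          ((W.baseChange K).quadraticTwist β).HasEntireLFunction →
          ((W.baseChange K).quadraticTwist β).entireLFunction 1 ≠ 0 →
          Finite (AddCommGroup.primaryComponent ((W.baseChange K).quadraticTwist β).sha 3) ∧
            ∃ qβ : ℚ, analyticSha ((W.baseChange K).quadraticTwist β) = (qβ : ℂ) ∧
              (padicValNat 3
                  (Nat.card (AddCommGroup.primaryComponent ((W.baseChange K).quadraticTwist β).sha 3)) : ℤ) ≤
                padicValRat 3 qβ)
    (K2aRest19 :
      ∀ (W : WeierstrassCurve ℚ) [W.IsElliptic] [W.IsGloballyMinimal],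
        ¬ W.HasCM → Addv W 3 → Summit.BirchSwinnertonDyer.Rank1Residual.Additive.SubTprime W 3 →
        W.analyticRank = 1 →
        ¬ (∃ (ℓ₀ : ℕ) (_ : Fact ℓ₀.Prime), ℓ₀ ≠ 3 ∧ W.HasMultiplicativeReductionAtPrime ℓ₀) →
        ∀ (d : ℤ), 0 < d → padicValInt 3 d = 1 →
        ∀ (K : Type) [Field K] [NumberField K] (θ₁ : K), Module.finrank ℚ K = 2 → θ₁ ^ 2 = (d : K) →
          ∃ β : K,
            (∀ v : HeightOneSpectrum (𝓞 K), ((3 : ℕ) : 𝓞 K) ∈ v.asIdeal →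
              ∃ k : ℤ, v.valuation K β = WithZero.exp (2 * k + 1)) ∧
            (∀ σ : K →+* ℝ, 0 < σ β) ∧
            ∃ (Vβ : WeierstrassCurve K) (_ : Vβ.IsElliptic),
              (∃ C : WeierstrassCurve.VariableChange K, C • (W.baseChange K).quadraticTwist β = Vβ) ∧
              Vβ.HasEntireLFunction ∧
              Finite (AddCommGroup.primaryComponent Vβ.sha 3) ∧
              ∃ qβ : ℚ, analyticSha Vβ = (qβ : ℂ) ∧
                (padicValNat 3 (Nat.card (AddCommGroup.primaryComponent Vβ.sha 3)) : ℤ) ≤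
                  padicValRat 3 qβ) :
    KolyvaginTwistedUpperOverKNoOddMult :=
  kolyvaginTwistedUpperOverKNoOddMult_of_ES0two_of_allAdditive hmod hFH hFH'
    (fun W _ _ hCM hadd hsub hr h2m ↦
      K2aES0any W hCM hadd hsub hr ⟨2, inferInstance, by decide, h2m⟩)
    K2aRest19

/-- **The parent `SolventPairLowerBound` (stmt-BirchSwinnertonDyer-21391) BY NAME from its filed children
`SolventPublishedInputs` (23962), `LowerBSD3OverSolventQuartic` (23963, K1⁻), `KolyvaginUpperRankZeroOverK` (23964,
K2a-ES₀) BY NAME, plus the any-`ℓ₀` Friedberg–Hoffstein fact (p587947), the dyadic Euler-system half K2a-ES₀⁽²⁾ and the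
all-additive residue K2a-rest₁₉** — i.e. beyond the filed K1⁻ and K2a-ES₀, the parent needs exactly: the same rank-zero
Euler-system engine on the 52 classes whose only multiplicative prime is `2`, and the 19 all-additive classes. Through
the generated glue's closer `solventPairLowerBound_of_published_of_K1low_of_K2aES0_of_K2aRest` (p586547) and
`kolyvaginTwistedUpperOverKNoOddMult_of_ES0two_of_allAdditive`. CONDITIONAL; credits nothing.
[cite: DokchitserDokchitserAnnals2010, §2.1 Thm. 2.3] [cite: FriedbergHoffstein1995, Thm. B (1)]
[cite: GrossZagier1986, Thm. I.(7.3)] [cite: Milne1972ArithmeticAV, §1 Thm. 1] -/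
theorem solventPairLowerBound_of_children_of_ES0two_of_allAdditive (hPUB : SolventPublishedInputs)
    (hFH : friedbergHoffstein_exists_twist_ne_zero_realQuadratic_tameAtThree_anyMult)
    (hK1 : LowerBSD3OverSolventQuartic) (hES0 : KolyvaginUpperRankZeroOverK)
    (K2aES0two :
      ∀ (W : WeierstrassCurve ℚ) [W.IsElliptic] [W.IsGloballyMinimal],
        ¬ W.HasCM → Addv W 3 → Summit.BirchSwinnertonDyer.Rank1Residual.Additive.SubTprime W 3 →
        W.analyticRank = 1 → W.HasMultiplicativeReductionAtPrime 2 →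
        ∀ (d : ℤ), 0 < d → padicValInt 3 d = 1 →
        ∀ (K : Type) [Field K] [NumberField K] (θ₁ : K), Module.finrank ℚ K = 2 → θ₁ ^ 2 = (d : K) →
        ∀ β : K,
          (∀ v : HeightOneSpectrum (𝓞 K), ((3 : ℕ) : 𝓞 K) ∈ v.asIdeal →
            ∃ k : ℤ, v.valuation K β = WithZero.exp (2 * k + 1)) →
          (∀ σ : K →+* ℝ, 0 < σ β) →
          ((W.baseChange K).quadraticTwist β).HasEntireLFunction →
          ((W.baseChange K).quadraticTwist β).entireLFunction 1 ≠ 0 →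
          Finite (AddCommGroup.primaryComponent ((W.baseChange K).quadraticTwist β).sha 3) ∧
            ∃ qβ : ℚ, analyticSha ((W.baseChange K).quadraticTwist β) = (qβ : ℂ) ∧
              (padicValNat 3
                  (Nat.card (AddCommGroup.primaryComponent ((W.baseChange K).quadraticTwist β).sha 3)) : ℤ) ≤
                padicValRat 3 qβ)
    (K2aRest19 :
      ∀ (W : WeierstrassCurve ℚ) [W.IsElliptic] [W.IsGloballyMinimal],
        ¬ W.HasCM → Addv W 3 → Summit.BirchSwinnertonDyer.Rank1Residual.Additive.SubTprime W 3 →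
        W.analyticRank = 1 →
        ¬ (∃ (ℓ₀ : ℕ) (_ : Fact ℓ₀.Prime), ℓ₀ ≠ 3 ∧ W.HasMultiplicativeReductionAtPrime ℓ₀) →
        ∀ (d : ℤ), 0 < d → padicValInt 3 d = 1 →
        ∀ (K : Type) [Field K] [NumberField K] (θ₁ : K), Module.finrank ℚ K = 2 → θ₁ ^ 2 = (d : K) →
          ∃ β : K,
            (∀ v : HeightOneSpectrum (𝓞 K), ((3 : ℕ) : 𝓞 K) ∈ v.asIdeal →
              ∃ k : ℤ, v.valuation K β = WithZero.exp (2 * k + 1)) ∧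
            (∀ σ : K →+* ℝ, 0 < σ β) ∧
            ∃ (Vβ : WeierstrassCurve K) (_ : Vβ.IsElliptic),
              (∃ C : WeierstrassCurve.VariableChange K, C • (W.baseChange K).quadraticTwist β = Vβ) ∧
              Vβ.HasEntireLFunction ∧
              Finite (AddCommGroup.primaryComponent Vβ.sha 3) ∧
              ∃ qβ : ℚ, analyticSha Vβ = (qβ : ℂ) ∧
                (padicValNat 3 (Nat.card (AddCommGroup.primaryComponent Vβ.sha 3)) : ℤ) ≤
                  padicValRat 3 qβ) :
    SolventPairLowerBound := by
  have hP : exists_isNewformOf ∧ nonempty_modularParametrizationData ∧ GrossZagier1986_thm_I_7_3 ∧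
      rank_eq_analyticRank_of_analyticRank_le_one ∧ Milne1972.bsdQuotientP_baseChange_relQuadratic_anyModel ∧
      friedbergHoffstein_exists_pos_twist_ne_zero_ramifiedAtThree ∧
      friedbergHoffstein_exists_twist_ne_zero_realQuadratic_tameAtThree ∧
      friedbergHoffstein_exists_twist_ne_zero_realQuadratic_tameAtThree_noflip := hPUB
  exact solventPairLowerBound_of_published_of_K1low_of_K2aES0_of_K2aRest hP hK1 hES0
    (kolyvaginTwistedUpperOverKNoOddMult_of_ES0two_of_allAdditive hP.1 hFH hP.2.2.2.2.2.2.2 K2aES0two K2aRest19)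

/-- **The parent `SolventPairLowerBound` BY NAME from `SolventPublishedInputs` (23962) · the any-`ℓ₀` fact (p587947) ·
`LowerBSD3OverSolventQuartic` (23963, K1⁻) · K2a-ES₀′ · K2a-rest₁₉** — the one-line closer of a v7 re-cut
`K1⁻ · K2a-ES₀′ (3 514 classes) · K2a-rest₁₉ (19 classes)` of the parent (K2a-ES₀′ = 23964's text with `ℓ₀ ≠ 2` dropped;
it implies 23964 by name and K2a-ES₀⁽²⁾). CONDITIONAL; credits nothing.
[cite: DokchitserDokchitserAnnals2010, §2.1 Thm. 2.3] [cite: FriedbergHoffstein1995, Thm. B (1)]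
[cite: GrossZagier1986, Thm. I.(7.3)] [cite: Milne1972ArithmeticAV, §1 Thm. 1] -/
theorem solventPairLowerBound_of_published_of_K1low_of_K2aES0any_of_allAdditive (hPUB : SolventPublishedInputs)
    (hFH : friedbergHoffstein_exists_twist_ne_zero_realQuadratic_tameAtThree_anyMult)
    (hK1 : LowerBSD3OverSolventQuartic)
    (K2aES0any :
      ∀ (W : WeierstrassCurve ℚ) [W.IsElliptic] [W.IsGloballyMinimal],
        ¬ W.HasCM → Addv W 3 → Summit.BirchSwinnertonDyer.Rank1Residual.Additive.SubTprime W 3 →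
        W.analyticRank = 1 →
        (∃ (ℓ₀ : ℕ) (_ : Fact ℓ₀.Prime), ℓ₀ ≠ 3 ∧ W.HasMultiplicativeReductionAtPrime ℓ₀) →
        ∀ (d : ℤ), 0 < d → padicValInt 3 d = 1 →
        ∀ (K : Type) [Field K] [NumberField K] (θ₁ : K), Module.finrank ℚ K = 2 → θ₁ ^ 2 = (d : K) →
        ∀ β : K,
          (∀ v : HeightOneSpectrum (𝓞 K), ((3 : ℕ) : 𝓞 K) ∈ v.asIdeal →
            ∃ k : ℤ, v.valuation K β = WithZero.exp (2 * k + 1)) →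
          (∀ σ : K →+* ℝ, 0 < σ β) →
          ((W.baseChange K).quadraticTwist β).HasEntireLFunction →
          ((W.baseChange K).quadraticTwist β).entireLFunction 1 ≠ 0 →
          Finite (AddCommGroup.primaryComponent ((W.baseChange K).quadraticTwist β).sha 3) ∧
            ∃ qβ : ℚ, analyticSha ((W.baseChange K).quadraticTwist β) = (qβ : ℂ) ∧
              (padicValNat 3
                  (Nat.card (AddCommGroup.primaryComponent ((W.baseChange K).quadraticTwist β).sha 3)) : ℤ) ≤
                padicValRat 3 qβ)
    (K2aRest19 :
      ∀ (W : WeierstrassCurve ℚ) [W.IsElliptic] [W.IsGloballyMinimal],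
        ¬ W.HasCM → Addv W 3 → Summit.BirchSwinnertonDyer.Rank1Residual.Additive.SubTprime W 3 →
        W.analyticRank = 1 →
        ¬ (∃ (ℓ₀ : ℕ) (_ : Fact ℓ₀.Prime), ℓ₀ ≠ 3 ∧ W.HasMultiplicativeReductionAtPrime ℓ₀) →
        ∀ (d : ℤ), 0 < d → padicValInt 3 d = 1 →
        ∀ (K : Type) [Field K] [NumberField K] (θ₁ : K), Module.finrank ℚ K = 2 → θ₁ ^ 2 = (d : K) →
          ∃ β : K,
            (∀ v : HeightOneSpectrum (𝓞 K), ((3 : ℕ) : 𝓞 K) ∈ v.asIdeal →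
              ∃ k : ℤ, v.valuation K β = WithZero.exp (2 * k + 1)) ∧
            (∀ σ : K →+* ℝ, 0 < σ β) ∧
            ∃ (Vβ : WeierstrassCurve K) (_ : Vβ.IsElliptic),
              (∃ C : WeierstrassCurve.VariableChange K, C • (W.baseChange K).quadraticTwist β = Vβ) ∧
              Vβ.HasEntireLFunction ∧
              Finite (AddCommGroup.primaryComponent Vβ.sha 3) ∧
              ∃ qβ : ℚ, analyticSha Vβ = (qβ : ℂ) ∧
                (padicValNat 3 (Nat.card (AddCommGroup.primaryComponent Vβ.sha 3)) : ℤ) ≤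
                  padicValRat 3 qβ) :
    SolventPairLowerBound :=
  solventPairLowerBound_of_children_of_ES0two_of_allAdditive hPUB hFH hK1
    (fun W _ _ hCM hadd hsub hr hodd ↦
      K2aES0any W hCM hadd hsub hr (exists_mult_ne_three_of_exists_oddMult W hodd))
    (fun W _ _ hCM hadd hsub hr h2m ↦ K2aES0any W hCM hadd hsub hr ⟨2, inferInstance, by decide, h2m⟩)
    K2aRest19

end Summit.BirchSwinnertonDyer.BirchSwinnertonDyer.Theorems.SolventPairLowerBound

end
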